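import Literature.NumberTheory.EllipticCurves.ModularJacobianMultiplicityOneOfGaloisDatum
import Literature.NumberTheory.EllipticCurves.ModularJacobianGaloisDataExists
import Literature.NumberTheory.GaloisRepresentations.ChebotarevOpenSubgroup
import Literature.NumberTheory.GaloisRepresentations.FramedRepCharpolyModules
import Mathlib.LinearAlgebra.Matrix.Charpoly.Coeff
import HarnessLib

/-!
# The Galois action on `J₀(N)[𝔪]` satisfies the Boston–Lenstra–Ribet relations
# (Eichler–Shimura + Chebotarev; Mazur 1977 II.14, Buzzard 2000 proof of Prop. 2.4)

Datum (i) of `buzzard2000_multiplicityOne_gamma0_of_abstractGaloisDatum`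
(`ModularJacobianMultiplicityOneOfGaloisDatum.lean`) made a THEOREM relative to the tree's interface
for the `ℚ`-structure of the modular Jacobian, `ModularJacobianGaloisData N ι`
(`AlgebraicModularParametrizationWithShift.lean`: a `𝕋_ℤ`-linear action `galAct` of `Γ_ℚ` on
`J0.tors N = J₀(N)(ℂ)_tors` with open point stabilisers; existence is the cited fact
`nonempty_modularJacobianGaloisData`), plus the Eichler–Shimura relation for that action, taken as
an explicit hypothesis `hD` (Darmon–Diamond–Taylor Thm. 1.29, p. 37: "`T_p = F + ⟨p⟩F'` on
`J_Γ/𝔽_p` for `p ∤ N`", read on prime-to-`p` torsion through an arithmetic Frobenius as in the proof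
of their Thm. 3.1(a), p. 86).

Printed argument formalised here (Mazur II.14; Ribet–Stein §3.3; Buzzard 2000 p. 101; Darmon–
Diamond–Taylor §4.5 p. 135): `Γ_ℚ` acts `𝕋/𝔪`-linearly on `V = J₀(N)[𝔪]`; the joint kernel of this
action and of `ρ : Γ_ℚ → GL₂(k)` is open and normal, so by Chebotarev (tree, PROVED:
`exists_isArithFrobAt_mul_inv_mem_not_mem`) every `g ∈ Γ_ℚ` agrees, on `V` and under `ρ`, with an
arithmetic Frobenius `φ` above some `p ∤ 2N`; there Eichler–Shimura gives `φ² - T_p φ + p = 0` on `V`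
and `ρ ≅ ρ_𝔪` gives `charpoly ρ(φ) = X² - ι(T_p) X + p`; hence for EVERY `g`:
`σ(g)² - t(g) σ(g) + n(g) = 0` with `ι(t g) = tr ρ(g)`, `ι(n g) = det ρ(g)` — [BLR]'s hypothesis.

* `exists_representation_torsionBySet_of_galoisData`, `isOpen_ker_of_agree_galAct` — the datum's
  action on `J0 N[𝔪]` as a `𝕋/𝔪`-linear representation `σ` agreeing with `galAct`; open kernel.
* `exists_charpolyRel_torsionBySet_of_galoisData` — the theorem described above (datum (i)).
* `buzzard2000_multiplicityOne_gamma0_of_galoisData` — Buzzard's Prop. 2.4 (the cited fact) from a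
  Galois datum with Eichler–Shimura and ONE residual hypothesis on it: a `σ`-stable subspace
  `U ≤ J0 N[𝔪]` with commuting action and `dim (J0 N[𝔪] ⧸ U) ≤ 2` (print: `J₀(N)[𝔪] ∩ ker(J₀ → J₁)`,
  abelian by Buzzard's Lemma 2.3 ⟸ Ling–Oesterlé; codimension `≤ 2` by appendix Thm. 6.1 on `J₁(N)`).

HONESTY: reductions only. The Eichler–Shimura relation and the `J₁(N)` inputs are hypotheses; the
fact `buzzard2000_multiplicityOne_gamma0` stays cited; no summit statement is proved here.
References: [Mazur1977] Prop. II.14.2; [DarmonDiamondTaylor1995] Thm. 1.29 (p. 37), proof of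
Thm. 3.1(a) (p. 86), §4.5 (p. 135); [Buzzard2000LevelLoweringModTwo] Lemma 2.3, proof of Prop. 2.4
(p. 101); [RibetStein2008] §3.3 and appendix Thm. 6.1.
-/

noncomputable section

open scoped MatrixGroups ModularForm NumberField

open CongruenceSubgroup Polynomial IsDedekindDomain

namespace Literature.NumberTheory.EllipticCurves.ModularForms

open GaloisRepresentations Rat.HeightOneSpectrum

variable (N : ℕ) [NeZero N]

/-! ### The Galois datum restricted to `J0 N[𝔪]` -/

/-- **The Galois action on `J₀(N)[𝔪]` as a `𝕋/𝔪`-linear representation.** For a Galois datum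
`D : ModularJacobianGaloisData N ι` (a `𝕋_ℤ`-linear action of `Γ_ℚ` on `J0.tors N`) and an ideal
`𝔪 ∋ ℓ ≠ 0` of `𝕋_ℤ`, the `𝔪`-torsion `J0 N[𝔪] ⊆ J0.tors N` is `Γ_ℚ`-stable (`𝕋_ℤ`-linearity) and
the induced action is `𝕋/𝔪`-linear: there is a representation `σ` of `Γ_ℚ` on the `𝕋/𝔪`-space
`J0 N[𝔪]` agreeing with `D.galAct` pointwise. (Darmon–Diamond–Taylor §4.5, p. 135: "Consider now the
action of `G_ℚ` on … this `T/m`-vector space".)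
[cite: DarmonDiamondTaylor1995, §4.5 (p. 135)] -/
theorem exists_representation_torsionBySet_of_galoisData (𝔪 : Ideal (HeckeRing0 N 2))
    {ℓ : ℕ} (hℓ : ℓ ≠ 0) (hℓ𝔪 : (ℓ : HeckeRing0 N 2) ∈ 𝔪)
    {ι : AlgebraicClosure ℚ →+* ℂ} (D : ModularJacobianGaloisData N ι) :
    ∃ σ : Representation (HeckeRing0 N 2 ⧸ 𝔪) (Field.absoluteGaloisGroup ℚ)
        (Submodule.torsionBySet (HeckeRing0 N 2) (J0 N) 𝔪),
      ∀ (g : Field.absoluteGaloisGroup ℚ) (x : Submodule.torsionBySet (HeckeRing0 N 2) (J0 N) 𝔪)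
        (x' : J0.tors N), (x' : J0 N) = x →
        ((σ g x : Submodule.torsionBySet (HeckeRing0 N 2) (J0 N) 𝔪) : J0 N)
          = ((D.galAct g x' : J0.tors N) : J0 N) := by
  set V := Submodule.torsionBySet (HeckeRing0 N 2) (J0 N) 𝔪 with hV
  have hVt : ∀ x : V, (x : J0 N) ∈ J0.tors N := fun x =>
    J0.torsionBy_le_tors N hℓ (J0.torsionBySet_le_torsionBy N hℓ𝔪 x.2)
  let lift : V → J0.tors N := fun x => ⟨x, hVt x⟩
  have hlift : ∀ x : V, ((lift x : J0.tors N) : J0 N) = x := fun x => rfl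
  have hmem : ∀ (g : Field.absoluteGaloisGroup ℚ) (x : V),
      ((D.galAct g (lift x) : J0.tors N) : J0 N) ∈ V := by
    intro g x
    rw [hV, Submodule.mem_torsionBySet_iff]
    rintro ⟨a, ha⟩
    have hx : a • lift x = 0 := by
      apply Subtype.ext
      show a • (x : J0 N) = 0
      exact (Submodule.mem_torsionBySet_iff _ _).mp x.2 ⟨a, ha⟩
    have h := congrArg (fun y : J0.tors N => (y : J0 N)) (map_smul (D.galAct g) a (lift x))
    simp only [hx, map_zero] at h
    -- `h : (0 : J0 N) = ↑(a • D.galAct g (lift x))`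
    simpa using h.symm
  let σ₀ : Field.absoluteGaloisGroup ℚ → V →ₗ[HeckeRing0 N 2] V := fun g =>
    { toFun := fun x => ⟨_, hmem g x⟩
      map_add' := fun x y => by
        apply Subtype.ext
        show ((D.galAct g (lift (x + y)) : J0.tors N) : J0 N)
          = (D.galAct g (lift x) : J0 N) + (D.galAct g (lift y) : J0 N)
        have e : lift (x + y) = lift x + lift y := Subtype.ext rfl
        rw [e, map_add]
        rfl
      map_smul' := fun a x => by
        apply Subtype.ext
        show ((D.galAct g (lift (a • x)) : J0.tors N) : J0 N) = a • (D.galAct g (lift x) : J0 N)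
        have e : lift (a • x) = a • lift x := Subtype.ext rfl
        rw [e, map_smul]
        rfl }
  have hσ₀ : ∀ (g : Field.absoluteGaloisGroup ℚ) (x : V),
      ((σ₀ g x : V) : J0 N) = (D.galAct g (lift x) : J0 N) := fun g x => rfl
  have hsurj : Function.Surjective (algebraMap (HeckeRing0 N 2) (HeckeRing0 N 2 ⧸ 𝔪)) :=
    Ideal.Quotient.mk_surjective
  refine ⟨{ toFun := fun g => (σ₀ g).extendScalarsOfSurjective hsurj
            map_one' := ?_
            map_mul' := ?_ }, ?_⟩
  · apply LinearMap.ext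
    intro x
    apply Subtype.ext
    show ((σ₀ 1 x : V) : J0 N) = x
    rw [hσ₀, map_one]
    rfl
  · intro g h
    apply LinearMap.ext
    intro x
    apply Subtype.ext
    show ((σ₀ (g * h) x : V) : J0 N) = ((σ₀ g (σ₀ h x) : V) : J0 N)
    rw [hσ₀, hσ₀, map_mul, LinearEquiv.mul_apply]
    have e : lift (σ₀ h x) = D.galAct h (lift x) := Subtype.ext (hσ₀ h x)
    rw [e]
  · intro g x x' hx'
    have e : x' = lift x := Subtype.ext hx'
    rw [e]
    exact hσ₀ g x

/-- **The kernel of the Galois action on `J₀(N)[𝔪]` is open**: `J0 N[𝔪]` is finite (`𝔪 ∋ ℓ ≠ 0`)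
and every torsion point has an open stabiliser (`ModularJacobianGaloisData.isOpen_stabilizer` —
torsion points are defined over number fields), so the pointwise stabiliser of `J0 N[𝔪]` is a finite
intersection of open subgroups. [cite: DarmonDiamondTaylor1995, §4.5 (p. 135)] -/
theorem isOpen_ker_of_agree_galAct (𝔪 : Ideal (HeckeRing0 N 2))
    {ℓ : ℕ} (hℓ : ℓ ≠ 0) (hℓ𝔪 : (ℓ : HeckeRing0 N 2) ∈ 𝔪)
    {ι : AlgebraicClosure ℚ →+* ℂ} (D : ModularJacobianGaloisData N ι)
    (σ : Representation (HeckeRing0 N 2 ⧸ 𝔪) (Field.absoluteGaloisGroup ℚ)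
      (Submodule.torsionBySet (HeckeRing0 N 2) (J0 N) 𝔪))
    (hσ : ∀ (g : Field.absoluteGaloisGroup ℚ) (x : Submodule.torsionBySet (HeckeRing0 N 2) (J0 N) 𝔪)
        (x' : J0.tors N), (x' : J0 N) = x →
        ((σ g x : Submodule.torsionBySet (HeckeRing0 N 2) (J0 N) 𝔪) : J0 N)
          = ((D.galAct g x' : J0.tors N) : J0 N)) :
    IsOpen ((MonoidHom.ker σ : Subgroup (Field.absoluteGaloisGroup ℚ)) :
      Set (Field.absoluteGaloisGroup ℚ)) := by
  set V := Submodule.torsionBySet (HeckeRing0 N 2) (J0 N) 𝔪 with hV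
  have hVt : ∀ x : V, (x : J0 N) ∈ J0.tors N := fun x =>
    J0.torsionBy_le_tors N hℓ (J0.torsionBySet_le_torsionBy N hℓ𝔪 x.2)
  haveI : Finite V := J0.finite_torsionBySet N hℓ hℓ𝔪
  have hset : ((MonoidHom.ker σ : Subgroup (Field.absoluteGaloisGroup ℚ)) :
      Set (Field.absoluteGaloisGroup ℚ))
        = ⋂ x : V, {g | D.galAct g ⟨x, hVt x⟩ = ⟨x, hVt x⟩} := by
    ext g
    simp only [SetLike.mem_coe, MonoidHom.mem_ker, Set.mem_iInter, Set.mem_setOf_eq]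
    constructor
    · intro h x
      apply Subtype.ext
      have e := hσ g x ⟨x, hVt x⟩ rfl
      rw [h] at e
      exact e.symm
    · intro h
      apply LinearMap.ext
      intro x
      apply Subtype.ext
      have e := hσ g x ⟨x, hVt x⟩ rfl
      rw [h x] at e
      exact e
  rw [hset]
  exact isOpen_iInter_of_finite fun x => D.isOpen_stabilizer _

/-! ### Datum (i): the Boston–Lenstra–Ribet relations on `J0 N[𝔪]` -/

set_option maxHeartbeats 400000 in
/-- **Eichler–Shimura + Chebotarev ⇒ the [BLR] relations on `J₀(N)[𝔪]`** (Mazur 1977 II.14.2;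
Buzzard 2000, proof of Prop. 2.4; Darmon–Diamond–Taylor §4.5 p. 135). Hypotheses: `𝔪 ∋ 2` an ideal
of `𝕋_ℤ` at odd... any level `N`; `k ⊇ 𝕋/𝔪` via `ι`, with the discrete topology; `ρ : Γ_ℚ → GL₂(k)`
continuous, unramified at `v ∤ 2N` with `charpoly ρ(Frob_v) = X² - ι(T_p) X + p` (`ρ ≅ ρ_𝔪`, the
hypothesis of `buzzard2000_multiplicityOne_gamma0`); a Galois datum `D` on `J0.tors N` satisfying
the Eichler–Shimura relation `φ² - T_p φ + p = 0` on the `2`-torsion for every arithmetic Frobenius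
`φ` above `p ∤ 2N` (`hD`; Darmon–Diamond–Taylor Thm. 1.29). Conclusion: a `𝕋/𝔪`-linear
representation `σ` of `Γ_ℚ` on `J0 N[𝔪]` agreeing with `D.galAct`, and `t, n : Γ_ℚ → 𝕋/𝔪` with
`ι(t g) = tr ρ(g)`, `ι(n g) = det ρ(g)`, `σ(g)² - t(g) σ(g) + n(g) = 0` for ALL `g` — the
hypothesis of Boston–Lenstra–Ribet (tree: `CharpolyQuotientRankTwo*`). Chebotarev enters through
the tree's proved `exists_isArithFrobAt_mul_inv_mem_not_mem` applied to the open normal subgroup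
`ker σ ∩ ker ρ`. [cite: DarmonDiamondTaylor1995, Thm. 1.29 (p. 37) and §4.5 (p. 135)]
[cite: Buzzard2000LevelLoweringModTwo, proof of Prop. 2.4 (p. 101)] -/
theorem exists_charpolyRel_torsionBySet_of_galoisData (𝔪 : Ideal (HeckeRing0 N 2))
    (h2 : (2 : HeckeRing0 N 2) ∈ 𝔪)
    {k : Type*} [Field k] [TopologicalSpace k] [DiscreteTopology k]
    (ι : HeckeRing0 N 2 ⧸ 𝔪 →+* k) (ρ : ModPGaloisRep ℚ k 2)
    (hES : ∀ v : HeightOneSpectrum (𝓞 ℚ), ¬ ((primesEquiv v : Nat.Primes) : ℕ) ∣ 2 * N →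
      ρ.IsUnramifiedAt v ∧
        ρ.HasFrobCharpolyAt v
          (X ^ 2
            - C (ι (Ideal.Quotient.mk 𝔪 (HeckeRing0.T N 2
                ((primesEquiv v : Nat.Primes) : ℕ) (primesEquiv v : Nat.Primes).2))) * X
            + C (((primesEquiv v : Nat.Primes) : ℕ) : k)))
    {ιℂ : AlgebraicClosure ℚ →+* ℂ} (D : ModularJacobianGaloisData N ιℂ)
    (hD : ∀ v : HeightOneSpectrum (𝓞 ℚ), ¬ ((primesEquiv v : Nat.Primes) : ℕ) ∣ 2 * N →
      ∀ 𝔓 ∈ v.primesAbove, ∀ φ : Field.absoluteGaloisGroup ℚ, IsArithFrobAt (𝓞 ℚ) φ 𝔓 →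
      ∀ x : J0.tors N, (2 : HeckeRing0 N 2) • x = 0 →
        D.galAct φ (D.galAct φ x)
          - (HeckeRing0.T N 2 ((primesEquiv v : Nat.Primes) : ℕ) (primesEquiv v : Nat.Primes).2)
              • D.galAct φ x
          + (((primesEquiv v : Nat.Primes) : ℕ) : HeckeRing0 N 2) • x = 0) :
    ∃ (σ : Representation (HeckeRing0 N 2 ⧸ 𝔪) (Field.absoluteGaloisGroup ℚ)
        (Submodule.torsionBySet (HeckeRing0 N 2) (J0 N) 𝔪))
      (t n : Field.absoluteGaloisGroup ℚ → HeckeRing0 N 2 ⧸ 𝔪),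
      (∀ (g : Field.absoluteGaloisGroup ℚ) (x : Submodule.torsionBySet (HeckeRing0 N 2) (J0 N) 𝔪)
        (x' : J0.tors N), (x' : J0 N) = x →
        ((σ g x : Submodule.torsionBySet (HeckeRing0 N 2) (J0 N) 𝔪) : J0 N)
          = ((D.galAct g x' : J0.tors N) : J0 N)) ∧
      ∀ g : Field.absoluteGaloisGroup ℚ,
        ι (t g) = ((ρ g : GL (Fin 2) k) : Matrix (Fin 2) (Fin 2) k).trace ∧
        ι (n g) = ((ρ g : GL (Fin 2) k) : Matrix (Fin 2) (Fin 2) k).det ∧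
        σ g * σ g - t g • σ g + n g •
          (1 : Module.End (HeckeRing0 N 2 ⧸ 𝔪)
            (Submodule.torsionBySet (HeckeRing0 N 2) (J0 N) 𝔪)) = 0 := by
  classical
  set V := Submodule.torsionBySet (HeckeRing0 N 2) (J0 N) 𝔪 with hV
  have h2' : ((2 : ℕ) : HeckeRing0 N 2) ∈ 𝔪 := by exact_mod_cast h2
  have hVt : ∀ x : V, (x : J0 N) ∈ J0.tors N := fun x =>
    J0.torsionBy_le_tors N two_ne_zero (J0.torsionBySet_le_torsionBy N h2' x.2)
  obtain ⟨σ, hσ⟩ := exists_representation_torsionBySet_of_galoisData N 𝔪 two_ne_zero h2' D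
  -- the joint kernel `K = ker σ ∩ ker ρ`, an open normal subgroup
  set K : Subgroup (Field.absoluteGaloisGroup ℚ) := (MonoidHom.prod σ ρ.toMonoidHom).ker with hK
  haveI : K.Normal := MonoidHom.normal_ker _
  have hρker : IsOpen ((ρ.toMonoidHom.ker : Subgroup (Field.absoluteGaloisGroup ℚ)) :
      Set (Field.absoluteGaloisGroup ℚ)) := by
    have e : ((ρ.toMonoidHom.ker : Subgroup (Field.absoluteGaloisGroup ℚ)) :
        Set (Field.absoluteGaloisGroup ℚ)) = ρ ⁻¹' {1} := by
      ext g
      simp [MonoidHom.mem_ker]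
    rw [e]
    exact (isOpen_discrete _).preimage (map_continuous ρ)
  have hKopen : IsOpen (K : Set (Field.absoluteGaloisGroup ℚ)) := by
    have e : (K : Set (Field.absoluteGaloisGroup ℚ)) =
        ((MonoidHom.ker σ : Subgroup (Field.absoluteGaloisGroup ℚ)) :
            Set (Field.absoluteGaloisGroup ℚ)) ∩
          ((ρ.toMonoidHom.ker : Subgroup (Field.absoluteGaloisGroup ℚ)) :
            Set (Field.absoluteGaloisGroup ℚ)) := by
      ext g
      simp [hK, MonoidHom.mem_ker, Prod.ext_iff]
    rw [e]
    exact (isOpen_ker_of_agree_galAct N 𝔪 two_ne_zero h2' D σ hσ).inter hρker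
  -- the finite set of places dividing `2N`
  have hS : {v : HeightOneSpectrum (𝓞 ℚ) | ((primesEquiv v : Nat.Primes) : ℕ) ∣ 2 * N}.Finite := by
    have hfin : {q : Nat.Primes | (q : ℕ) ∣ 2 * N}.Finite := by
      refine ((2 * N).primeFactors.finite_toSet.preimage
        Nat.Primes.coe_nat_injective.injOn).subset ?_
      intro q hq
      simp only [Set.mem_preimage, Finset.mem_coe, Nat.mem_primeFactors]
      exact ⟨q.2, hq, mul_ne_zero two_ne_zero (NeZero.ne N)⟩
    have e : {v : HeightOneSpectrum (𝓞 ℚ) | ((primesEquiv v : Nat.Primes) : ℕ) ∣ 2 * N} =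
        primesEquiv ⁻¹' {q : Nat.Primes | (q : ℕ) ∣ 2 * N} := rfl
    rw [e]
    exact Set.Finite.preimage primesEquiv.injective.injOn hfin
  -- for each `g`, a Frobenius in the coset `g K` outside `2N`
  have main : ∀ g : Field.absoluteGaloisGroup ℚ, ∃ t n : HeckeRing0 N 2 ⧸ 𝔪,
      ι t = ((ρ g : GL (Fin 2) k) : Matrix (Fin 2) (Fin 2) k).trace ∧
      ι n = ((ρ g : GL (Fin 2) k) : Matrix (Fin 2) (Fin 2) k).det ∧
      σ g * σ g - t • σ g + n • (1 : Module.End (HeckeRing0 N 2 ⧸ 𝔪) V) = 0 := by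
    intro g
    obtain ⟨v, hvS, -, 𝔓, h𝔓, φ, hφ, hmem⟩ :=
      exists_isArithFrobAt_mul_inv_mem_not_mem ℚ K hKopen g _ hS
    have hker : σ (φ * g⁻¹) = 1 ∧ ρ.toMonoidHom (φ * g⁻¹) = 1 := by
      have h := (MonoidHom.mem_ker).1 hmem
      rwa [MonoidHom.prod_apply, Prod.mk_eq_one] at h
    have hσeq : σ φ = σ g := by
      have h1 : σ (φ * g⁻¹) * σ g = σ g := by rw [hker.1, one_mul]
      rwa [← map_mul, inv_mul_cancel_right] at h1
    have hρeq : ρ φ = ρ g := by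
      have h1 := hker.2
      rw [map_mul, map_inv, mul_inv_eq_one] at h1
      exact h1
    set p : Nat.Primes := primesEquiv v with hp
    -- Eichler–Shimura on `V` at `φ`
    have hESV : σ φ * σ φ - (Ideal.Quotient.mk 𝔪 (HeckeRing0.T N 2 (p : ℕ) p.2)) • σ φ
        + (Ideal.Quotient.mk 𝔪 ((p : ℕ) : HeckeRing0 N 2)) •
          (1 : Module.End (HeckeRing0 N 2 ⧸ 𝔪) V) = 0 := by
      apply LinearMap.ext
      intro x
      apply Subtype.ext
      have hx2 : (2 : HeckeRing0 N 2) • (⟨x, hVt x⟩ : J0.tors N) = 0 :=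
        Subtype.ext ((Submodule.mem_torsionBySet_iff _ _).mp x.2 ⟨2, h2⟩)
      have hE := congrArg (fun y : J0.tors N => (y : J0 N))
        (hD v hvS 𝔓 h𝔓 φ hφ ⟨x, hVt x⟩ hx2)
      have e1 : ((σ φ x : V) : J0 N) = (D.galAct φ ⟨x, hVt x⟩ : J0 N) := hσ φ x ⟨x, hVt x⟩ rfl
      have e2 : ((σ φ (σ φ x) : V) : J0 N) = (D.galAct φ (D.galAct φ ⟨x, hVt x⟩) : J0 N) :=
        hσ φ (σ φ x) (D.galAct φ ⟨x, hVt x⟩) e1.symm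
      simp only [Submodule.coe_add, Submodule.coe_sub, Submodule.coe_smul, LinearMap.add_apply,
        LinearMap.sub_apply, LinearMap.smul_apply, Module.End.mul_apply, Module.End.one_apply,
        LinearMap.zero_apply, Submodule.coe_zero, Submodule.torsionBySet.mk_smul] at hE ⊢
      rw [e2, e1]
      exact hE
    -- the characteristic polynomial of `ρ φ`
    obtain ⟨-, hch⟩ := hES v hvS
    have hP : ((ρ φ : GL (Fin 2) k) : Matrix (Fin 2) (Fin 2) k).charpoly =
        X ^ 2 - C (ι (Ideal.Quotient.mk 𝔪 (HeckeRing0.T N 2 (p : ℕ) p.2))) * X + C ((p : ℕ) : k) :=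
      hch 𝔓 h𝔓 φ hφ
    have htr : ((ρ φ : GL (Fin 2) k) : Matrix (Fin 2) (Fin 2) k).trace =
        ι (Ideal.Quotient.mk 𝔪 (HeckeRing0.T N 2 (p : ℕ) p.2)) := by
      rw [Matrix.trace_eq_neg_charpoly_coeff, hP]
      simp
    have hdet : ((ρ φ : GL (Fin 2) k) : Matrix (Fin 2) (Fin 2) k).det = ((p : ℕ) : k) := by
      rw [Matrix.det_eq_sign_charpoly_coeff, hP]
      simp
    refine ⟨Ideal.Quotient.mk 𝔪 (HeckeRing0.T N 2 (p : ℕ) p.2),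
      Ideal.Quotient.mk 𝔪 ((p : ℕ) : HeckeRing0 N 2), ?_, ?_, ?_⟩
    · rw [← hρeq]
      exact htr.symm
    · have e : ι (Ideal.Quotient.mk 𝔪 ((p : ℕ) : HeckeRing0 N 2)) = ((p : ℕ) : k) := by
        rw [map_natCast, map_natCast]
      rw [e, ← hρeq]
      exact hdet.symm
    · -- transport the relation from `φ` to `g` pointwise (`σ g = σ φ`)
      apply LinearMap.ext
      intro x
      have ex : σ g x = σ φ x := (DFunLike.congr_fun hσeq x).symm
      have ex2 : σ g (σ φ x) = σ φ (σ φ x) := (DFunLike.congr_fun hσeq (σ φ x)).symm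
      have hE := DFunLike.congr_fun hESV x
      simp only [LinearMap.add_apply, LinearMap.sub_apply, LinearMap.smul_apply, Module.End.mul_apply,
        Module.End.one_apply, LinearMap.zero_apply] at hE ⊢
      simp only [ex, ex2]
      exact hE
  choose t n ht hn hrel using main
  exact ⟨σ, t, n, hσ, fun g => ⟨ht g, hn g, hrel g⟩⟩

/-! ### Buzzard 2000 Prop. 2.4 from a Galois datum with Eichler–Shimura and the `J₁` input -/

/-- **Buzzard 2000 Prop. 2.4 (the cited `buzzard2000_multiplicityOne_gamma0`) from a Galois datum
with Eichler–Shimura plus ONE residual input.** Suppose that for every instance of the fact's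
binders and hypotheses (`N` odd, `𝔪 ∋ 2` maximal, `k ⊇ 𝕋/𝔪` algebraically closed, `ρ ≅ ρ_𝔪`
irreducible and non-scalar on `D₂`) one is given: an embedding `ιℂ : ℚ̄ → ℂ` and a Galois datum
`D : ModularJacobianGaloisData N ιℂ` (cited existence: `nonempty_modularJacobianGaloisData`)
satisfying the Eichler–Shimura relation `φ² - T_p φ + p = 0` on `J₀(N)[2]` at arithmetic Frobenius
elements above `p ∤ 2N` (Darmon–Diamond–Taylor Thm. 1.29), AND, for the (unique) `𝕋/𝔪`-linear
representation `σ` on `J0 N[𝔪]` agreeing with `D.galAct`, a `σ`-stable subspace `U` with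
commuting action and `dim (J0 N[𝔪] ⧸ U) ≤ 2` — in print `U = J₀(N)[𝔪] ∩ ker(J₀(N) → J₁(N))`,
abelian by Buzzard's Lemma 2.3 (Ling–Oesterlé) and of codimension `≤ 2` by Thm. 6.1 of Buzzard's
appendix to Ribet–Stein (`dim J₁(N)[𝔪] = 2`). THEN the fact holds: the [BLR] relations come from
`exists_charpolyRel_torsionBySet_of_galoisData` (Chebotarev, proved in the tree), absolute
irreducibility in Burnside's form from `FramedRep.lift_coe_surjective_of_isIrreducible`, and the
count from `finrank_torsionBySet_J0_eq_two_of_abstractDatum`. A reduction, not a proof of the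
input. [cite: Buzzard2000LevelLoweringModTwo, Lemma 2.3 and proof of Prop. 2.4 (p. 101)]
[cite: DarmonDiamondTaylor1995, Thm. 1.29 (p. 37) and §4.5 (p. 135)] -/
theorem buzzard2000_multiplicityOne_gamma0_of_galoisData
    (hD : ∀ (N : ℕ) [NeZero N], Odd N →
      ∀ (𝔪 : Ideal (HeckeRing0 N 2)), 𝔪.IsMaximal → (2 : HeckeRing0 N 2) ∈ 𝔪 →
      ∀ (k : Type) [Field k] [IsAlgClosed k] [TopologicalSpace k] [DiscreteTopology k]
        (ι : HeckeRing0 N 2 ⧸ 𝔪 →+* k) (ρ : ModPGaloisRep ℚ k 2),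
        (∀ v : HeightOneSpectrum (𝓞 ℚ), ¬ ((primesEquiv v : Nat.Primes) : ℕ) ∣ 2 * N →
          ρ.IsUnramifiedAt v ∧
            ρ.HasFrobCharpolyAt v
              (X ^ 2
                - C (ι (Ideal.Quotient.mk 𝔪 (HeckeRing0.T N 2
                    ((primesEquiv v : Nat.Primes) : ℕ) (primesEquiv v : Nat.Primes).2))) * X
                + C (((primesEquiv v : Nat.Primes) : ℕ) : k))) →
        FramedRep.IsIrreducible ρ →
        (∀ v : HeightOneSpectrum (𝓞 ℚ), ((primesEquiv v : Nat.Primes) : ℕ) = 2 →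
          ∀ 𝔓 ∈ v.primesAbove, ∃ σ ∈ 𝔓.decompositionSubgroup (Field.absoluteGaloisGroup ℚ),
            ∀ c : k, ((ρ σ : GL (Fin 2) k) : Matrix (Fin 2) (Fin 2) k) ≠ Matrix.scalar (Fin 2) c) →
        ∃ (ιℂ : AlgebraicClosure ℚ →+* ℂ) (D : ModularJacobianGaloisData N ιℂ),
          (∀ v : HeightOneSpectrum (𝓞 ℚ), ¬ ((primesEquiv v : Nat.Primes) : ℕ) ∣ 2 * N →
            ∀ 𝔓 ∈ v.primesAbove, ∀ φ : Field.absoluteGaloisGroup ℚ, IsArithFrobAt (𝓞 ℚ) φ 𝔓 →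
            ∀ x : J0.tors N, (2 : HeckeRing0 N 2) • x = 0 →
              D.galAct φ (D.galAct φ x)
                - (HeckeRing0.T N 2 ((primesEquiv v : Nat.Primes) : ℕ)
                    (primesEquiv v : Nat.Primes).2) • D.galAct φ x
                + (((primesEquiv v : Nat.Primes) : ℕ) : HeckeRing0 N 2) • x = 0) ∧
          ∀ σ : Representation (HeckeRing0 N 2 ⧸ 𝔪) (Field.absoluteGaloisGroup ℚ)
              (Submodule.torsionBySet (HeckeRing0 N 2) (J0 N) 𝔪),
            (∀ (g : Field.absoluteGaloisGroup ℚ)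
                (x : Submodule.torsionBySet (HeckeRing0 N 2) (J0 N) 𝔪) (x' : J0.tors N),
                (x' : J0 N) = x →
                ((σ g x : Submodule.torsionBySet (HeckeRing0 N 2) (J0 N) 𝔪) : J0 N)
                  = ((D.galAct g x' : J0.tors N) : J0 N)) →
            ∃ U : Submodule (HeckeRing0 N 2 ⧸ 𝔪) (Submodule.torsionBySet (HeckeRing0 N 2) (J0 N) 𝔪),
              (∀ (g : Field.absoluteGaloisGroup ℚ), ∀ x ∈ U, σ g x ∈ U) ∧
              (∀ (g h : Field.absoluteGaloisGroup ℚ), ∀ x ∈ U, σ g (σ h x) = σ h (σ g x)) ∧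
              Module.finrank (HeckeRing0 N 2 ⧸ 𝔪)
                (Submodule.torsionBySet (HeckeRing0 N 2) (J0 N) 𝔪 ⧸ U) ≤ 2) :
    buzzard2000_multiplicityOne_gamma0 := by
  intro N _ hN 𝔪 h𝔪 h2 k _ _ _ _ ι ρ hES hirr hns
  obtain ⟨ιℂ, D, hDES, hUσ⟩ := hD N hN 𝔪 h𝔪 h2 k ι ρ hES hirr hns
  obtain ⟨σ, t, n, hσ, hrel⟩ :=
    exists_charpolyRel_torsionBySet_of_galoisData N 𝔪 h2 ι ρ hES D hDES
  obtain ⟨U, hU, hcomm, hdim⟩ := hUσ σ hσ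
  haveI := h𝔪
  have hρ := ρ.lift_coe_surjective_of_isIrreducible hirr
  refine finrank_torsionBySet_J0_eq_two_of_abstractDatum N 𝔪 (ℓ := 2) two_ne_zero
    (by exact_mod_cast h2) ι ((Units.coeHom (Matrix (Fin 2) (Fin 2) k)).comp ρ.toMonoidHom) hρ
    σ t n (fun g => ?_) U hU hcomm hdim
  simpa using hrel g

end Literature.NumberTheory.EllipticCurves.ModularForms

end
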